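import Literature.Probability.RandomPlanarGeometry.SLEKappaRhoSchemeDriver
import Literature.Probability.RandomPlanarGeometry.SLEKappaRhoControlledJets
import Literature.Probability.RandomPlanarGeometry.SLERestrictionProcesses
import Literature.Probability.RandomPlanarGeometry.SLERestrictionSmooth
import Literature.Probability.RandomPlanarGeometry.StarHullSubStep
import Literature.Probability.RandomPlanarGeometry.SLEKappaRhoSlidArc
import HarnessLib

/-!
# The localising times of [LSW] Lemma 8.9 for SLE(8/3, ρ): controls, levels, stopping times

G. F. Lawler, O. Schramm, W. Werner, *Conformal restriction: the chordal case*, J. Amer. Math.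
Soc. **16** (2003) 917–955 (**[LSW]**), §8.4: "`(M_t, t < T)` is a local martingale". We make
the localisation explicit. Fix the level index `k`; with the driver `drvC J ρ (k+1)` of
`SLEKappaRhoSchemeDriver` (truncated clock at level `k + 1`) the CONTROLS are the continuous
adapted processes

* `ctlR` — the alive functional `aliveFn` (`≈ min_{s ≤ t} dist(0, B_s) ∧ 1`),
* `ctlD = min (Φ'_{B_t}(0) 𝟙{alive}) aliveFn`, `ctlC = min (clearance of the negative axis) aliveFn`
  (`SLEKappaRhoControls`),
* `|W|`, the truncated clock, and time,

and the LOCALISING TIME `tauK k` is the minimum of their hitting times of the closed sets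
`(−∞, ℓ_k]` (resp. `[k, ∞)`) and of the constant `k + 1`, where the level
`ℓ_k = min (1/(k+1)) ℓ_A` is at most the (deterministic, positive) initial values of the controls
(`initLevel`, `initLevel_le_ctl*_zero`). We prove:

* `isStoppingTime_tauK` — **`tauK k` is a stopping time** of the raw Brownian filtration
  (hitting times of closed sets by continuous adapted processes);
* `controls_of_le_tauK` — **closed controls up to and including `tauK k`**: alive,
  `Φ'_{B_t}(0) ≥ ℓ_k`, the balls `B(x, ℓ_k)` around the negative axis and `B(0, ℓ_k)` miss `B_t`,
  `|W_t| ≤ k`, clock `≤ k`, `t ≤ k + 1`; whence `|o_t| ≤ 3k` and a JET CONTROL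
  `JetControl (starMap B_t) (ℓ_k/2) η_k (3k)` with constants depending on `k` only
  (`jetControl_of_le_tauK`, via `SLEKappaRho.jetControl_of_controls`; `B_t` is an arc `+`-hull);
* `tauK_mono` — **`tauK k ≤ tauK (k+1)` for every sample** (locality: up to `tauK k` the clock
  is `≤ k`, so the drivers of levels `k + 1` and `k + 2` agree, hence so do all controls).

No named facts.
-/

noncomputable section

open Set Filter Metric Function MeasureTheory
open _root_.Complex _root_.Topology
open scoped NNReal ENNReal
open Literature.Probability.Process

namespace Literature.Probability.RandomPlanarGeometry

namespace SLEKappaRho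

open Loewner

variable {J : ℝ≥0 → (ℝ≥0 → ℝ) → ℝ} {ρ : ℝ} {A : Set ℂ}

/-! ### The controls (the negative axis is the tree's `nonposAxis`) -/

/-- The level index as a truncation level `k + 1 : ℝ≥0`. [folklore] -/
def lvlN (k : ℕ) : ℝ≥0 := (k : ℝ≥0) + 1

/-- `lvlN k = k + 1` as a real number. [folklore] -/
@[simp] theorem coe_lvlN (k : ℕ) : ((lvlN k : ℝ≥0) : ℝ) = k + 1 := by simp [lvlN]

/-- The truncation levels increase. [folklore] -/
theorem lvlN_le_succ (k : ℕ) : lvlN k ≤ lvlN (k + 1) := by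
  rw [← NNReal.coe_le_coe, coe_lvlN, coe_lvlN]; push_cast; linarith

section Controls

/-- The alive control at level `c`. [folklore] -/
def ctlR (J : ℝ≥0 → (ℝ≥0 → ℝ) → ℝ) (ρ : ℝ) (hA : IsStarHull A) (hne : A.Nonempty) (c : ℝ≥0) (t : ℝ≥0) (ω : ℝ≥0 → ℝ) : ℝ :=
  aliveFn (denseSeq hA hne) (drvPath J ρ c) t ω

/-- The derivative control at level `c`. [folklore] -/
def ctlD (J : ℝ≥0 → (ℝ≥0 → ℝ) → ℝ) (ρ : ℝ) (hA : IsStarHull A) (hne : A.Nonempty) (c : ℝ≥0) (t : ℝ≥0) (ω : ℝ≥0 → ℝ) : ℝ :=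
  derivCtl 1 A (denseSeq hA hne) (drvPath J ρ c) t ω

/-- The clearance control at level `c`. [folklore] -/
def ctlC (J : ℝ≥0 → (ℝ≥0 → ℝ) → ℝ) (ρ : ℝ) (hA : IsStarHull A) (hne : A.Nonempty) (c : ℝ≥0) (t : ℝ≥0) (ω : ℝ≥0 → ℝ) : ℝ :=
  clearCtl 1 nonposAxis (denseSeq hA hne) (drvPath J ρ c) t ω

variable {hA : IsStarHull A} {hne : A.Nonempty} {c : ℝ≥0}

/-- The controls have continuous paths, every sample. [folklore] -/
theorem continuous_ctl (ω : ℝ≥0 → ℝ) :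
    Continuous (fun t ↦ ctlR J ρ hA hne c t ω) ∧ Continuous (fun t ↦ ctlD J ρ hA hne c t ω) ∧
      Continuous (fun t ↦ ctlC J ρ hA hne c t ω) := by
  have hsp := denseSeq_spec hA hne
  have hW := continuous_drvPath (J := J) (ρ := ρ) (c := c) ω
  have hW0 := drvPath_zero (J := J) (ρ := ρ) (c := c) ω
  exact ⟨continuous_aliveFn (W := drvPath J ρ c) hW hW0 hA hne hsp.1 hsp.2,
    continuous_derivCtl (W := drvPath J ρ c) hW hW0 hA hne hsp.1 hsp.2 zero_le_one,
    continuous_clearCtl (W := drvPath J ρ c) hW hW0 hA hne hsp.1 hsp.2 zero_le_one⟩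

/-- The controls are adapted. [folklore] -/
theorem adapted_ctl (hJ : IsStronglyProgressive brownianFiltration J) :
    Adapted brownianFiltration (ctlR J ρ hA hne c) ∧ Adapted brownianFiltration (ctlD J ρ hA hne c) ∧
      Adapted brownianFiltration (ctlC J ρ hA hne c) := by
  have hsp := denseSeq_spec hA hne
  have haH : ∀ k, 0 < (denseSeq hA hne k).im := fun k ↦ (hsp.1 k).2
  refine ⟨fun t ↦ ?_, fun t ↦ ?_, fun t ↦ ?_⟩
  · exact measurable_aliveFn (mΩ := brownianFiltration t) (W := drvPath J ρ c) (fun ω ↦ continuous_drvPath ω)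
      (fun _ hs ↦ measurable_drvC_of_le hJ hs) haH
  · exact measurable_derivCtl (mΩ := brownianFiltration t) (W := drvPath J ρ c) (fun ω ↦ continuous_drvPath ω)
      (fun ω ↦ drvPath_zero ω) (fun _ hs ↦ measurable_drvC_of_le hJ hs) hA hne haH 1
  · exact measurable_clearCtl (mΩ := brownianFiltration t) (W := drvPath J ρ c) (fun ω ↦ continuous_drvPath ω)
      (fun _ hs ↦ measurable_drvC_of_le hJ hs) haH 1

end Controls

/-! ### Initial values and levels -/

section Levels

/-- **The initial level `ℓ_A > 0`**: a deterministic lower bound for the three controls at time `0`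
(`min (dist(0, A) ∧ 1) (Φ'_A(0)) (dist(A, (−∞,0]))`). [folklore] -/
def initLevel (A : Set ℂ) : ℝ :=
  min (min (infDist 0 A) 1) (min (starDeriv A) (sInf ((fun z ↦ infDist z nonposAxis) '' A)))

/-- The distance from the compact `+`-hull to the closed negative axis is positive. [folklore] -/
theorem sInf_infDist_nonposAxis_pos (hA : IsPlusHull A) (hne : A.Nonempty) : 0 < sInf ((fun z ↦ infDist z nonposAxis) '' A) := by
  have hcpt : IsCompact A := hA.1.isBoundedHull.isCompact
  obtain ⟨z₀, hz₀, hmin⟩ := hcpt.exists_isMinOn hne (continuous_infDist_pt nonposAxis).continuousOn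
  have hclosed : IsClosed nonposAxis := isClosed_nonposAxis
  have hpos : 0 < infDist z₀ nonposAxis := by
    have hnot : z₀ ∉ nonposAxis := by
      intro hz
      rw [mem_nonposAxis_iff] at hz
      have hreal : ((z₀.re : ℝ) : ℂ) = z₀ := Complex.ext (by simp) (by simp [hz.1])
      have := hA.2 z₀.re (by rw [hreal]; exact hz₀)
      linarith [hz.2]
    exact (hclosed.notMem_iff_infDist_pos ⟨0, ⟨0, mem_Iic.2 le_rfl, by simp⟩⟩).1 hnot
  have heq : sInf ((fun z ↦ infDist z nonposAxis) '' A) = infDist z₀ nonposAxis := by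
    refine le_antisymm (csInf_le ⟨0, by rintro _ ⟨z, -, rfl⟩; exact infDist_nonneg⟩ ⟨z₀, hz₀, rfl⟩) ?_
    exact le_csInf (hne.image _) (by rintro _ ⟨z, hz, rfl⟩; exact hmin hz)
  rw [heq]; exact hpos

/-- **`0 < initLevel A`.** [folklore] -/
theorem initLevel_pos (hA : IsPlusHull A) (hne : A.Nonempty) : 0 < initLevel A :=
  lt_min (lt_min (infDist_zero_pos hA.1 hne).1 one_pos) (lt_min (starDeriv_spec hA.1).1 (sInf_infDist_nonposAxis_pos hA hne))

/-- `initLevel ≤ 1`. [folklore] -/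
theorem initLevel_le_one : initLevel A ≤ 1 := (min_le_left _ _).trans (min_le_right _ _)

/-- **The level `ℓ_k = min (1/(k+1)) ℓ_A`.** [folklore] -/
def lvl (A : Set ℂ) (k : ℕ) : ℝ := min (locLevel k) (initLevel A)

/-- `0 < ℓ_k ≤ initLevel`, `ℓ_k ≤ 1/(k+1)`, `ℓ_k ≤ 1`. [folklore] -/
theorem lvl_pos_le (hA : IsPlusHull A) (hne : A.Nonempty) (k : ℕ) : 0 < lvl A k ∧ lvl A k ≤ initLevel A ∧ lvl A k ≤ locLevel k ∧ lvl A k ≤ 1 :=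
  ⟨lt_min (locLevel_pos_le k).1 (initLevel_pos hA hne), min_le_right _ _, min_le_left _ _,
    (min_le_left _ _).trans (locLevel_pos_le k).2⟩

/-- The levels decrease. [folklore] -/
theorem lvl_succ_le (k : ℕ) : lvl A (k + 1) ≤ lvl A k := by
  refine min_le_min ?_ le_rfl
  rw [locLevel, locLevel]
  exact one_div_le_one_div_of_le (by positivity) (by push_cast; linarith)

variable {hA : IsPlusHull A} {hne : A.Nonempty}

/-- Time `0` is alive. [folklore] -/
theorem alive_zero (hA : IsStarHull A) (c : ℝ≥0) (ω : ℝ≥0 → ℝ) : Disjoint (closedHull (drvPath J ρ c ω) 0) A := by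
  rw [Set.disjoint_left]
  intro z hz hzA
  have hT : swallowingTime (drvPath J ρ c ω) z ≤ ((0 : ℝ≥0) : WithTop ℝ≥0) := hz.2
  have hz0 : z ≠ drvPath J ρ c ω 0 := by
    rw [drvPath_zero]; intro h
    exact hA.zero_notMem (by rw [Complex.ofReal_zero] at h; rwa [← h])
  have := swallowingTime_pos_holds (continuous_drvPath ω) hz0
  exact absurd (lt_of_lt_of_le this hT) (lt_irrefl _)

/-- **`initLevel ≤ ctlR 0`** (`aliveFn_0 ≥ dist(0, A) ∧ 1`). [folklore] -/
theorem initLevel_le_ctlR_zero (hA : IsPlusHull A) (hne : A.Nonempty) (c : ℝ≥0) (ω : ℝ≥0 → ℝ) :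
    initLevel A ≤ ctlR J ρ hA.1 hne c 0 ω := by
  have hsp := denseSeq_spec hA.1 hne
  refine le_trans (min_le_left _ _) ?_
  refine min_le_aliveFn (W := drvPath J ρ c) hA.1 (fun k ↦ (hsp.1 k).1) (fun s hs ↦ ?_) (fun s hs ↦ ?_)
  · rw [le_antisymm hs bot_le]; exact alive_zero hA.1 c ω
  · rw [le_antisymm hs bot_le]
    show infDist 0 A ≤ infDist 0 (slidHull (drvPath J ρ c ω) A 0)
    rw [slidHull_zero_of_eq_zero (continuous_drvPath ω) (drvPath_zero ω) hA.1]

/-- **`initLevel ≤ ctlD 0`.** [folklore] -/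
theorem initLevel_le_ctlD_zero (hA : IsPlusHull A) (hne : A.Nonempty) (c : ℝ≥0) (ω : ℝ≥0 → ℝ) :
    initLevel A ≤ ctlD J ρ hA.1 hne c 0 ω := by
  have hR := initLevel_le_ctlR_zero (J := J) (ρ := ρ) hA hne c ω
  unfold ctlD derivCtl
  rw [one_mul]
  refine le_min ?_ hR
  rw [Set.indicator_of_mem (show ω ∈ {ω | Disjoint (closedHull (drvPath J ρ c ω) 0) A} from alive_zero hA.1 c ω)]
  have : slidHull (drvPath J ρ c ω) A 0 = A := slidHull_zero_of_eq_zero (continuous_drvPath ω) (drvPath_zero ω) hA.1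
  rw [this]
  exact (min_le_right _ _).trans (min_le_left _ _)

/-- **`initLevel ≤ ctlC 0`.** [folklore] -/
theorem initLevel_le_ctlC_zero (hA : IsPlusHull A) (hne : A.Nonempty) (c : ℝ≥0) (ω : ℝ≥0 → ℝ) :
    initLevel A ≤ ctlC J ρ hA.1 hne c 0 ω := by
  have hsp := denseSeq_spec hA.1 hne
  have hR := initLevel_le_ctlR_zero (J := J) (ρ := ρ) hA hne c ω
  unfold ctlC clearCtl
  rw [one_mul]
  refine le_min ?_ hR
  refine le_trans ((min_le_right _ _).trans (min_le_right _ _)) (le_ciInf fun k ↦ ?_)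
  -- the slid point at time `0` is the point itself
  have hz0 : denseSeq hA.1 hne k ≠ drvPath J ρ c ω 0 := by
    rw [drvPath_zero]; intro h
    have := (hsp.1 k).2; rw [h] at this; simp at this
  have hpt : slidPt (drvPath J ρ c) (denseSeq hA.1 hne) 0 k ω = denseSeq hA.1 hne k := by
    unfold slidPt
    rw [show (drvPath J ρ c ω) = drvPath J ρ c ω from rfl, map_zero_apply (continuous_drvPath ω) hz0, drvPath_zero]
    simp
  rw [hpt]
  exact csInf_le ⟨0, by rintro _ ⟨z, -, rfl⟩; exact infDist_nonneg⟩ ⟨_, (hsp.1 k).1, rfl⟩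

end Levels

/-! ### The localising times -/

section Tau

/-- **The localising time `τ_k`**: first time one of the controls (at driver level `k + 1`) reaches
its level, capped at `k + 1`. [cite: LawlerSchrammWerner2003Restriction, §8.4 ("(M_t, t < T) is a local martingale")] -/
def tauK (J : ℝ≥0 → (ℝ≥0 → ℝ) → ℝ) (ρ : ℝ) (hA : IsPlusHull A) (hne : A.Nonempty) (k : ℕ) (ω : ℝ≥0 → ℝ) : WithTop ℝ≥0 :=
  min (min (min (min (min
    (hittingAfter (ctlR J ρ hA.1 hne (lvlN k)) (Iic (lvl A k)) 0 ω)
    (hittingAfter (ctlD J ρ hA.1 hne (lvlN k)) (Iic (lvl A k)) 0 ω))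
    (hittingAfter (ctlC J ρ hA.1 hne (lvlN k)) (Iic (lvl A k)) 0 ω))
    (hittingAfter (fun t ω ↦ |drvC J ρ (lvlN k) t ω|) (Ici (k : ℝ)) 0 ω))
    (hittingAfter (clockTrunc J (lvlN k)) (Ici (k : ℝ)) 0 ω))
    ((lvlN k : ℝ≥0) : WithTop ℝ≥0)

variable {hA : IsPlusHull A} {hne : A.Nonempty}

/-- **`τ_k` is a stopping time** of the raw Brownian filtration. [folklore] -/
theorem isStoppingTime_tauK (hJ : IsStronglyProgressive brownianFiltration J) (k : ℕ) :
    IsStoppingTime brownianFiltration (tauK J ρ hA hne k) := by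
  obtain ⟨haR, haD, haC⟩ := adapted_ctl (J := J) (ρ := ρ) (hA := hA.1) (hne := hne) (c := lvlN k) hJ
  refine IsStoppingTime.min (IsStoppingTime.min (IsStoppingTime.min (IsStoppingTime.min (IsStoppingTime.min ?_ ?_) ?_) ?_) ?_)
    (isStoppingTime_const _ _)
  · exact isStoppingTime_hittingAfter_of_continuous haR (fun ω ↦ (continuous_ctl ω).1) isClosed_Iic
  · exact isStoppingTime_hittingAfter_of_continuous haD (fun ω ↦ (continuous_ctl ω).2.1) isClosed_Iic
  · exact isStoppingTime_hittingAfter_of_continuous haC (fun ω ↦ (continuous_ctl ω).2.2) isClosed_Iic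
  · exact isStoppingTime_hittingAfter_of_continuous (u := fun t ω ↦ |drvC J ρ (lvlN k) t ω|)
      (fun t ↦ measurable_abs.comp (adapted_drvC hJ t)) (fun ω ↦ (continuous_drvPath ω).abs) isClosed_Ici
  · exact isStoppingTime_hittingAfter_of_continuous (adapted_clockTrunc hJ _) (fun ω ↦ continuous_clockTrunc _ ω) isClosed_Ici

/-- `τ_k ≤ k + 1`. [folklore] -/
theorem tauK_le (k : ℕ) (ω : ℝ≥0 → ℝ) : tauK J ρ hA hne k ω ≤ ((lvlN k : ℝ≥0) : WithTop ℝ≥0) := min_le_right _ _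

/-- `τ_k` is finite. [folklore] -/
theorem tauK_ne_top (k : ℕ) (ω : ℝ≥0 → ℝ) : tauK J ρ hA hne k ω ≠ ⊤ :=
  ne_top_of_le_ne_top WithTop.coe_ne_top (tauK_le k ω)

/-- **Closed controls up to and including `τ_k`.** [folklore] -/
theorem controls_of_le_tauK {k : ℕ} {t : ℝ≥0} {ω : ℝ≥0 → ℝ} (ht : (t : WithTop ℝ≥0) ≤ tauK J ρ hA hne k ω) :
    lvl A k ≤ ctlR J ρ hA.1 hne (lvlN k) t ω ∧ lvl A k ≤ ctlD J ρ hA.1 hne (lvlN k) t ω ∧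
      lvl A k ≤ ctlC J ρ hA.1 hne (lvlN k) t ω ∧ |drvC J ρ (lvlN k) t ω| ≤ k ∧
      clockTrunc J (lvlN k) t ω ≤ k ∧ (t : ℝ) ≤ k + 1 := by
  have hℓ := (lvl_pos_le hA hne k).2.1
  have h1 : (t : WithTop ℝ≥0) ≤ hittingAfter (ctlR J ρ hA.1 hne (lvlN k)) (Iic (lvl A k)) 0 ω :=
    ht.trans ((min_le_left _ _).trans ((min_le_left _ _).trans ((min_le_left _ _).trans ((min_le_left _ _).trans (min_le_left _ _)))))
  have h2 : (t : WithTop ℝ≥0) ≤ hittingAfter (ctlD J ρ hA.1 hne (lvlN k)) (Iic (lvl A k)) 0 ω :=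
    ht.trans ((min_le_left _ _).trans ((min_le_left _ _).trans ((min_le_left _ _).trans ((min_le_left _ _).trans (min_le_right _ _)))))
  have h3 : (t : WithTop ℝ≥0) ≤ hittingAfter (ctlC J ρ hA.1 hne (lvlN k)) (Iic (lvl A k)) 0 ω :=
    ht.trans ((min_le_left _ _).trans ((min_le_left _ _).trans ((min_le_left _ _).trans (min_le_right _ _))))
  have h4 : (t : WithTop ℝ≥0) ≤ hittingAfter (fun t ω ↦ |drvC J ρ (lvlN k) t ω|) (Ici (k : ℝ)) 0 ω :=
    ht.trans ((min_le_left _ _).trans ((min_le_left _ _).trans (min_le_right _ _)))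
  have h5 : (t : WithTop ℝ≥0) ≤ hittingAfter (clockTrunc J (lvlN k)) (Ici (k : ℝ)) 0 ω :=
    ht.trans ((min_le_left _ _).trans (min_le_right _ _))
  have h6 : (t : ℝ) ≤ k + 1 := by
    have := ht.trans (min_le_right _ _)
    have : t ≤ lvlN k := by exact_mod_cast this
    rw [← coe_lvlN]; exact_mod_cast this
  obtain ⟨hcR, hcD, hcC⟩ := continuous_ctl (J := J) (ρ := ρ) (hA := hA.1) (hne := hne) (c := lvlN k) ω
  refine ⟨le_of_coe_le_hittingAfter hcR (hℓ.trans (initLevel_le_ctlR_zero hA hne _ ω)) h1,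
    le_of_coe_le_hittingAfter hcD (hℓ.trans (initLevel_le_ctlD_zero hA hne _ ω)) h2,
    le_of_coe_le_hittingAfter hcC (hℓ.trans (initLevel_le_ctlC_zero hA hne _ ω)) h3,
    le_of_coe_le_hittingAfter_Ici (X := fun t ω ↦ |drvC J ρ (lvlN k) t ω|) (continuous_drvPath ω).abs (by simp) h4,
    le_of_coe_le_hittingAfter_Ici (continuous_clockTrunc _ ω) (by simp) h5, h6⟩

/-- **Geometric consequences of the controls**: up to `τ_k`, `A` is alive, `Φ'_{B_t}(0) ≥ ℓ_k`,
the balls of radius `ℓ_k` around the negative axis and around `0` miss `B_t`, the clock is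
`≤ k`, and `|o_t| ≤ 3k`. [folklore] -/
theorem geometry_of_le_tauK {k : ℕ} {t : ℝ≥0} {ω : ℝ≥0 → ℝ} (ht : (t : WithTop ℝ≥0) ≤ tauK J ρ hA hne k ω) :
    Disjoint (closedHull (drvPath J ρ (lvlN k) ω) t) A ∧
      lvl A k ≤ starDeriv (slidHull (drvPath J ρ (lvlN k) ω) A t) ∧
      (∀ x ∈ nonposAxis, Disjoint (ball x (lvl A k)) (slidHull (drvPath J ρ (lvlN k) ω) A t)) ∧
      Disjoint (ball (0 : ℂ) (lvl A k)) (slidHull (drvPath J ρ (lvlN k) ω) A t) ∧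
      clock J t ω ≤ (k : ℝ≥0∞) ∧ |oposC J ρ (lvlN k) t ω| ≤ 3 * k := by
  obtain ⟨hR, hD, hC, hW, hI, -⟩ := controls_of_le_tauK ht
  have hsp := denseSeq_spec hA.1 hne
  have hℓ0 := (lvl_pos_le hA hne k).1
  have hWc := continuous_drvPath (J := J) (ρ := ρ) (c := lvlN k) ω
  have hW0 := drvPath_zero (J := J) (ρ := ρ) (c := lvlN k) ω
  obtain ⟨halive, hd⟩ := starDeriv_ge_of_le_derivCtl (W := drvPath J ρ (lvlN k)) hWc hW0 hA.1 hne hsp.1 hsp.2 zero_le_one hℓ0 hD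
  obtain ⟨-, hclear⟩ := clear_of_le_clearCtl (W := drvPath J ρ (lvlN k)) hWc hW0 hA.1 hne hsp.1 hsp.2 zero_le_one hℓ0 hC
  have hball := disjoint_ball_zero_of_le_mul_aliveFn (W := drvPath J ρ (lvlN k)) hWc hW0 hA.1 hne hsp.1 hsp.2 one_pos hℓ0
    (by rw [one_mul]; exact hR)
  rw [div_one] at hball
  have hclock : clock J t ω ≤ (k : ℝ≥0∞) := by
    have := clock_le_of_clockTrunc_le (J := J) (c := lvlN k) (k := (k : ℝ≥0)) (by rw [lvlN]; exact lt_add_one _) (t := t) (ω := ω)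
      (by exact_mod_cast hI)
    exact_mod_cast this
  refine ⟨halive, hd, hclear, hball, hclock, ?_⟩
  calc |oposC J ρ (lvlN k) t ω| ≤ |drvC J ρ (lvlN k) t ω| + 2 * clockTrunc J (lvlN k) t ω := abs_oposC_le t ω
    _ ≤ k + 2 * k := by gcongr
    _ = 3 * k := by ring

/-- **The jet control up to `τ_k`** (for a smooth `A ∈ 𝒬₊`): `JetControl (starMap B_t) (ℓ_k/2) η_k (3k)`
with `η_k = min (ℓ_k (ℓ_k/8)/320) 1`. [cite: LawlerSchrammWerner2003Restriction, §8.4 proof of Lemma 8.9] -/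
theorem jetControl_of_le_tauK (hAs : IsSmoothHull A) {k : ℕ} {t : ℝ≥0} {ω : ℝ≥0 → ℝ}
    (ht : (t : WithTop ℝ≥0) ≤ tauK J ρ hA hne k ω) :
    JetControl (starMap (slidHull (drvPath J ρ (lvlN k) ω) A t)) (lvl A k / 2)
      (min (lvl A k * (lvl A k / 8) / 320) 1) (3 * k) := by
  obtain ⟨halive, hd, hclear, -, -, -⟩ := geometry_of_le_tauK ht
  have hWc := continuous_drvPath (J := J) (ρ := ρ) (c := lvlN k) ω
  have hW0 := drvPath_zero (J := J) (ρ := ρ) (c := lvlN k) ω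
  have hBplus : IsPlusHull (slidHull (drvPath J ρ (lvlN k) ω) A t) := isPlusHull_slidHull_of_disjoint hWc hW0 hA halive
  have hBarc : IsArcHull (slidHull (drvPath J ρ (lvlN k) ω) A t) :=
    isArcHull_slidHull_of_disjoint hWc hAs.isArcHull hA.1.zero_notMem halive
  have hℓ0 := (lvl_pos_le hA hne k).1
  refine jetControl_of_controls hBplus hBarc hℓ0 hd (by positivity) (by positivity) fun x hx ↦ ?_
  rw [show 8 * (lvl A k / 8) = lvl A k by ring]
  exact hclear x ⟨x, hx.2, rfl⟩

/-! ### Monotonicity of the localising times -/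

/-- **Up to `τ_k` the drivers of levels `k + 1 ≤ c'` agree** (the clock is `≤ k`). [folklore] -/
theorem drvC_eq_of_le_tauK {k : ℕ} {t : ℝ≥0} {ω : ℝ≥0 → ℝ} (ht : (t : WithTop ℝ≥0) ≤ tauK J ρ hA hne k ω)
    {c' : ℝ≥0} (hc' : lvlN k ≤ c') {s : ℝ≥0} (hs : s ≤ t) : drvC J ρ (lvlN k) s ω = drvC J ρ c' s ω := by
  obtain ⟨-, -, -, -, hclock, -⟩ := geometry_of_le_tauK ht
  have hk : clock J t ω ≤ ((lvlN k : ℝ≥0) : ℝ≥0∞) := hclock.trans (by rw [lvlN]; exact_mod_cast (le_add_of_nonneg_right zero_le_one))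
  exact drvC_eq_of_clock_le hk hc' hs

/-- **`τ_k ≤ τ_{k+1}` for every sample.** [folklore] -/
theorem tauK_mono (k : ℕ) (ω : ℝ≥0 → ℝ) : tauK J ρ hA hne k ω ≤ tauK J ρ hA hne (k + 1) ω := by
  have hsp := denseSeq_spec hA.1 hne
  -- compare through the finite times below `τ_k`
  by_contra hba
  push Not at hba
  obtain ⟨t, hv⟩ := WithTop.ne_top_iff_exists.1 (ne_top_of_lt hba)
  suffices hmain : (t : WithTop ℝ≥0) < tauK J ρ hA hne (k + 1) ω by rw [hv] at hmain; exact lt_irrefl _ hmain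
  have ht : (t : WithTop ℝ≥0) < tauK J ρ hA hne k ω := by rw [hv]; exact hba
  -- strict controls on `[0, t]` at level `k`
  have hstrict : ∀ s : ℝ≥0, s ≤ t →
      lvl A k < ctlR J ρ hA.1 hne (lvlN k) s ω ∧ lvl A k < ctlD J ρ hA.1 hne (lvlN k) s ω ∧
        lvl A k < ctlC J ρ hA.1 hne (lvlN k) s ω ∧ |drvC J ρ (lvlN k) s ω| < k ∧ clockTrunc J (lvlN k) s ω < k := by
    intro s hs
    have hst : (s : WithTop ℝ≥0) < tauK J ρ hA hne k ω := lt_of_le_of_lt (by exact_mod_cast hs) ht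
    have h1 := lt_of_lt_of_le hst ((min_le_left _ _).trans ((min_le_left _ _).trans ((min_le_left _ _).trans ((min_le_left _ _).trans (min_le_left _ _)))))
    have h2 := lt_of_lt_of_le hst ((min_le_left _ _).trans ((min_le_left _ _).trans ((min_le_left _ _).trans ((min_le_left _ _).trans (min_le_right _ _)))))
    have h3 := lt_of_lt_of_le hst ((min_le_left _ _).trans ((min_le_left _ _).trans ((min_le_left _ _).trans (min_le_right _ _))))
    have h4 := lt_of_lt_of_le hst ((min_le_left _ _).trans ((min_le_left _ _).trans (min_le_right _ _)))
    have h5 := lt_of_lt_of_le hst ((min_le_left _ _).trans (min_le_right _ _))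
    exact ⟨not_le.1 (notMem_of_coe_lt_hittingAfter_zero (s := Iic (lvl A k)) h1),
      not_le.1 (notMem_of_coe_lt_hittingAfter_zero (s := Iic (lvl A k)) h2),
      not_le.1 (notMem_of_coe_lt_hittingAfter_zero (s := Iic (lvl A k)) h3),
      not_le.1 (notMem_of_coe_lt_hittingAfter_zero (u := fun t ω ↦ |drvC J ρ (lvlN k) t ω|) (s := Ici (k : ℝ)) h4),
      not_le.1 (notMem_of_coe_lt_hittingAfter_zero (s := Ici (k : ℝ)) h5)⟩
  have ht6 : (t : ℝ) < k + 1 := by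
    have := lt_of_lt_of_le ht (min_le_right _ _)
    have : t < lvlN k := by exact_mod_cast this
    rw [← coe_lvlN]; exact_mod_cast this
  -- the drivers of levels `k+1`, `k+2` agree on `[0, t]`
  have heq : ∀ s, s ≤ t → drvPath J ρ (lvlN k) ω s = drvPath J ρ (lvlN (k + 1)) ω s := fun s hs ↦
    drvC_eq_of_le_tauK ht.le (lvlN_le_succ k) hs
  have heq' : ∀ s, s ≤ t → ∀ r, r ≤ s → drvPath J ρ (lvlN k) ω r = drvPath J ρ (lvlN (k + 1)) ω r :=
    fun s hs r hr ↦ heq r (hr.trans hs)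
  have hWc : ∀ c : ℝ≥0, Continuous (drvPath J ρ c ω) := fun c ↦ continuous_drvPath ω
  have hlvl := lvl_succ_le (A := A) k
  obtain ⟨hcR, hcD, hcC⟩ := continuous_ctl (J := J) (ρ := ρ) (hA := hA.1) (hne := hne) (c := lvlN (k + 1)) ω
  refine lt_min (lt_min (lt_min (lt_min (lt_min ?_ ?_) ?_) ?_) ?_) ?_
  · refine coe_lt_hittingAfter_of_forall_lt hcR fun s hs ↦ ?_
    have := (hstrict s hs).1
    unfold ctlR at this ⊢
    rw [← aliveFn_congr (hWc _) (hWc _) (heq' s hs)]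
    linarith
  · refine coe_lt_hittingAfter_of_forall_lt hcD fun s hs ↦ ?_
    have := (hstrict s hs).2.1
    unfold ctlD at this ⊢
    rw [← derivCtl_congr (hWc _) (hWc _) (heq' s hs) hA.1 1]
    linarith
  · refine coe_lt_hittingAfter_of_forall_lt hcC fun s hs ↦ ?_
    have := (hstrict s hs).2.2.1
    unfold ctlC at this ⊢
    rw [← clearCtl_congr (hWc _) (hWc _) (drvPath_zero ω) (heq' s hs) hA.1 hsp.1 hsp.2 1]
    linarith
  · refine coe_lt_hittingAfter_Ici_of_forall_lt (X := fun t ω ↦ |drvC J ρ (lvlN (k + 1)) t ω|) (continuous_drvPath ω).abs fun s hs ↦ ?_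
    have := (hstrict s hs).2.2.2.1
    have he := heq s hs
    simp only [drvPath_apply] at he
    show |drvC J ρ (lvlN (k + 1)) s ω| < ((k + 1 : ℕ) : ℝ)
    rw [← he]; push_cast; linarith
  · refine coe_lt_hittingAfter_Ici_of_forall_lt (continuous_clockTrunc _ ω) fun s hs ↦ ?_
    have := (hstrict s hs).2.2.2.2
    obtain ⟨-, -, -, -, hclock, -⟩ := geometry_of_le_tauK ht.le
    have hk : clock J t ω ≤ ((lvlN k : ℝ≥0) : ℝ≥0∞) := hclock.trans (by rw [lvlN]; exact_mod_cast (le_add_of_nonneg_right zero_le_one))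
    rw [← clockTrunc_eq_of_clock_le hk (lvlN_le_succ k) hs]
    push_cast; linarith
  · have : t < lvlN (k + 1) := by
      rw [← NNReal.coe_lt_coe, coe_lvlN]; push_cast; linarith
    exact_mod_cast this

end Tau

end SLEKappaRho

end Literature.Probability.RandomPlanarGeometry

end
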